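import Literature.Probability.Percolation.TwoClusterConditionalAssociationProofs
import Literature.Probability.Percolation.KozmaNitzanPreFKG
import HarnessLib

/-!
# Crux `PercNearOneGluing.AdditiveGluing` (stmt-CriticalPhenomena-4576), line `tieline`:
# the three-cluster two-level inequality with a FREE third vertex (Step 1′ under `{u ↮ v}` alone)

Support file (`--supports stmt-CriticalPhenomena-4576`, helper, seat (d) exchange-certificate form); companion of
`…ThreeClusterTwoLevel.lean` (p184133; self-contained: it imports only the Literature BHK files).  No definitions, no named facts, no sorries.

There the passive third vertex `r` had to lie in the forbidden set `X` (so that on `D = {C_s ∩ X = ∅}` its cluster is a cluster of the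
configuration off `C̄_s`).  Here `r` is free, at the price of the hypothesis that `G(C_s, C_t, C_r)` does not depend on `C_r` whenever
`r` is a vertex of `C_s` (`r = s` or `r ∈ e ∈ C_s`) — exactly what the kernel's event satisfies: with `s = u`, `t = v ∈ X = {v}`,
`r = c`, the event `Z₁ = {u ↔ o} ∪ ({v ↮ o} ∩ ({u ↔ c} ∪ {c ↮ o}))` ("`o ∈ C_u`, or `o ∉ C_v` and `o` is not joined to `c` off
`C_u`") ignores `C_c` as soon as `c ∈ C_u`.  Results: `threeClusterTwoLevel_free` (the inequality
`μ(D) ∫_D F(C_t) G ≤ ∫_D F ∫_D G`, `D = {C_s ∩ X = ∅}`, `t ∈ X`, `r` free) and the event form `stepOne_event₁`: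
for `D = {u ↮ v}` and every event `A` increasing in `C_v`, `μ(D) μ(D ∩ A ∩ Z₁) ≤ μ(D ∩ A) μ(D ∩ Z₁)` — the provable half
("Step 1′", lead c9 §11e; seat (d) memo EXCHCERT-g4 §2/§5) of the kernel (T) = `stub_k0CovTransferQ_c9` under its own conditioning.
[cite: VandenbergHaggstromKahn2005, Thm. 1.5 (p. 7, eq. (9)), proof pp. 7–8; Thm. 1.3 (p. 6)]
-/

noncomputable section

open MeasureTheory unitInterval
open Literature.Probability.LatticeModels (prodBernoulli)
open Literature.Probability.Percolation

namespace Summit.CriticalPhenomena.PercolationContinuityZ3.Theorems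

namespace ThreeClusterTwoLevelFree

open scoped Classical
open BHK2006 DecisionTree

variable {V : Type*} [Fintype V]

/-- **Display (10) with the domain Markov property, set conditioning and three clusters**: for `t, r ∈ X` and
`D = {∀ x ∈ X, s ↮ x}`,
`E[H(C_s, C_t, C_r) 1_D] = Σ_ω weight(ω) (Σ_η weight(η) H(C_s(ω), C_t(η ∖ W̄), C_r(η ∖ W̄))) 1_D(ω)`, `W = C_s(ω)`.
[cite: VandenbergHaggstromKahn2005, §1 pp. 7–8, display (10)] -/
theorem sum_cond_cluster₃_free (w : Sym2 V → ℝ) (hm : ∑ ω, weight w ω = 1) (s t r : V) (X : Set V)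
    (ht : t ∈ X) (H : Set (Sym2 V) → Set (Sym2 V) → Set (Sym2 V) → ℝ)
    (hH0 : ∀ C T R R', (r = s ∨ ∃ e ∈ C, r ∈ e) → H C T R = H C T R') {D : Set (Set (Sym2 V))}
    (hD : ∀ ω, ω ∈ D ↔ ∀ x ∈ X, ¬ (openGraph ω).Reachable s x) :
    ∑ ω, weight w ω * (H (openEdgeCluster ω s) (openEdgeCluster ω t) (openEdgeCluster ω r) * ind D ω) =
      ∑ ω, weight w ω * ((∑ η, weight w η * H (openEdgeCluster ω s)
        (openEdgeCluster (η \ {e | ∃ v ∈ e, v = s ∨ ∃ e' ∈ openEdgeCluster ω s, v ∈ e'}) t)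
        (openEdgeCluster (η \ {e | ∃ v ∈ e, v = s ∨ ∃ e' ∈ openEdgeCluster ω s, v ∈ e'}) r)) * ind D ω) := by
  -- the identity on each event `{C_s = W}`
  have key : ∀ W : Set (Sym2 V),
      ∑ ω, (if openEdgeCluster ω s = W then
          weight w ω * (H W (openEdgeCluster ω t) (openEdgeCluster ω r) * ind D ω) else 0) =
      ∑ ω, (if openEdgeCluster ω s = W then
          weight w ω * ((∑ η, weight w η * H W
            (openEdgeCluster (η \ {e | ∃ v ∈ e, v = s ∨ ∃ e' ∈ W, v ∈ e'}) t)
            (openEdgeCluster (η \ {e | ∃ v ∈ e, v = s ∨ ∃ e' ∈ W, v ∈ e'}) r)) * ind D ω) else 0) := by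
    intro W
    by_cases hX : ∃ x ∈ X, x = s ∨ ∃ e ∈ W, x ∈ e
    · -- on `{C_s = W}` some `x ∈ X` is reached: both sides vanish termwise
      obtain ⟨x, hxX, hx⟩ := hX
      refine Finset.sum_congr rfl fun ω _ => ?_
      split_ifs with hW
      · have hreach : (openGraph ω).Reachable s x := by
          rw [reachable_iff_exists_mem_openEdgeCluster, hW]; exact hx
        simp only [ind_of_not_mem (fun h => (hD ω).1 h x hxX hreach), mul_zero]
      · rfl
    · push Not at hX
      have htW : ¬ (t = s ∨ ∃ e ∈ W, t ∈ e) := fun h => by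
        rcases h with h | ⟨e, he, hte⟩
        · exact (hX t ht).1 h
        · exact (hX t ht).2 e he hte
      -- block Fubini with the block `A = W̄`
      set A : Set (Sym2 V) := {e | ∃ v ∈ e, v = s ∨ ∃ e' ∈ W, v ∈ e'} with hA
      set Φ : Set (Sym2 V) → Set (Sym2 V) → ℝ := fun ζ η =>
        if openEdgeCluster ζ s = W then H W (openEdgeCluster (η \ A) t) (openEdgeCluster (η \ A) r) else 0 with hΦ
      have hind : ∀ ω, openEdgeCluster ω s = W → ind D ω = 1 := fun ω hW =>
        ind_of_mem ((hD ω).2 fun x hxX hreach => by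
          rw [reachable_iff_exists_mem_openEdgeCluster, hW] at hreach
          rcases hreach with h | ⟨e, he, hxe⟩
          · exact (hX x hxX).1 h
          · exact (hX x hxX).2 e he hxe)
      have h1 : ∀ ω, (if openEdgeCluster ω s = W then
          weight w ω * (H W (openEdgeCluster ω t) (openEdgeCluster ω r) * ind D ω) else 0) =
          weight w ω * Φ (ω ∩ A) (ω \ A) := by
        intro ω
        simp only [hΦ, hA, openEdgeCluster_inter_bar_eq_iff, openEdgeCluster_sdiff_sdiff]
        split_ifs with hW
        · have hr_eq : H W (openEdgeCluster (ω \ {e | ∃ v ∈ e, v = s ∨ ∃ e' ∈ W, v ∈ e'}) t) (openEdgeCluster ω r) =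
              H W (openEdgeCluster (ω \ {e | ∃ v ∈ e, v = s ∨ ∃ e' ∈ W, v ∈ e'}) t)
                (openEdgeCluster (ω \ {e | ∃ v ∈ e, v = s ∨ ∃ e' ∈ W, v ∈ e'}) r) := by
            by_cases hrW : (r = s ∨ ∃ e ∈ W, r ∈ e)
            · exact hH0 W _ _ _ hrW
            · rw [openEdgeCluster_eq_sdiff_bar hW hrW]
          rw [hind ω hW, mul_one, openEdgeCluster_eq_sdiff_bar hW htW, hr_eq]
        · rw [mul_zero]
      have h2 : ∀ ω, weight w ω * ∑ ω', weight w ω' * Φ (ω ∩ A) (ω' \ A) =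
          (if openEdgeCluster ω s = W then
            weight w ω * ((∑ η, weight w η * H W (openEdgeCluster (η \ A) t) (openEdgeCluster (η \ A) r)) *
              ind D ω)
          else 0) := by
        intro ω
        simp only [hΦ, hA, openEdgeCluster_inter_bar_eq_iff, openEdgeCluster_sdiff_sdiff]
        split_ifs with hW
        · rw [hind ω hW, mul_one]
        · simp
      calc ∑ ω, (if openEdgeCluster ω s = W then
              weight w ω * (H W (openEdgeCluster ω t) (openEdgeCluster ω r) * ind D ω) else 0)
          = (∑ ω, weight w ω) * ∑ ω, weight w ω * Φ (ω ∩ A) (ω \ A) := by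
            rw [hm, one_mul]; exact Finset.sum_congr rfl fun ω _ => h1 ω
        _ = ∑ ω, weight w ω * ∑ ω', weight w ω' * Φ (ω ∩ A) (ω' \ A) := blockFubini w A Φ
        _ = _ := Finset.sum_congr rfl fun ω _ => h2 ω
  -- sum over `W`
  calc ∑ ω, weight w ω * (H (openEdgeCluster ω s) (openEdgeCluster ω t) (openEdgeCluster ω r) * ind D ω)
      = ∑ ω, ∑ W, (if openEdgeCluster ω s = W then
          weight w ω * (H W (openEdgeCluster ω t) (openEdgeCluster ω r) * ind D ω) else 0) :=
        Finset.sum_congr rfl fun ω _ => (Fintype.sum_ite_eq (openEdgeCluster ω s)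
          fun W => weight w ω * (H W (openEdgeCluster ω t) (openEdgeCluster ω r) * ind D ω)).symm
    _ = ∑ W, ∑ ω, (if openEdgeCluster ω s = W then
          weight w ω * (H W (openEdgeCluster ω t) (openEdgeCluster ω r) * ind D ω) else 0) := Finset.sum_comm
    _ = ∑ W, ∑ ω, (if openEdgeCluster ω s = W then
          weight w ω * ((∑ η, weight w η * H W
            (openEdgeCluster (η \ {e | ∃ v ∈ e, v = s ∨ ∃ e' ∈ W, v ∈ e'}) t)
            (openEdgeCluster (η \ {e | ∃ v ∈ e, v = s ∨ ∃ e' ∈ W, v ∈ e'}) r)) * ind D ω) else 0) :=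
        Finset.sum_congr rfl fun W _ => key W
    _ = ∑ ω, ∑ W, (if openEdgeCluster ω s = W then
          weight w ω * ((∑ η, weight w η * H W
            (openEdgeCluster (η \ {e | ∃ v ∈ e, v = s ∨ ∃ e' ∈ W, v ∈ e'}) t)
            (openEdgeCluster (η \ {e | ∃ v ∈ e, v = s ∨ ∃ e' ∈ W, v ∈ e'}) r)) * ind D ω) else 0) :=
        Finset.sum_comm
    _ = _ :=
        Finset.sum_congr rfl fun ω _ => Fintype.sum_ite_eq (openEdgeCluster ω s)
          fun W => weight w ω * ((∑ η, weight w η * H W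
            (openEdgeCluster (η \ {e | ∃ v ∈ e, v = s ∨ ∃ e' ∈ W, v ∈ e'}) t)
            (openEdgeCluster (η \ {e | ∃ v ∈ e, v = s ∨ ∃ e' ∈ W, v ∈ e'}) r)) * ind D ω)

end ThreeClusterTwoLevelFree

open ThreeClusterTwoLevelFree BHK2006 DecisionTree in
/-- **Three-cluster two-level negative correlation, free third vertex.**  For a finite vertex type, `μ = prodBernoulli w`,
a source `s`, a set `X ∌ s` with `t ∈ X`, a vertex `r` (free; `G` must ignore `C_r` when `r` is a vertex of `C_s`), `D = {ω | ∀ x ∈ X, s ↮ x}`, `F ≥ 0` increasing (read on `C_t`) and `G` increasing in its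
first and decreasing in its second and third arguments (read on `(C_s, C_t, C_r)`):
`μ(D) · ∫_D F(C_t) G(C_s,C_t,C_r) dμ ≤ (∫_D F(C_t) dμ) · (∫_D G(C_s,C_t,C_r) dμ)`.
(BHK 2006 Thm. 1.5's proof with a forbidden set and a passive third cluster.)
[cite: VandenbergHaggstromKahn2005, Thm. 1.5 (p. 7), proof pp. 7–8; Thm. 1.3 (p. 6)] -/
theorem threeClusterTwoLevel_free {V : Type} [Fintype V] (w : Sym2 V → unitInterval) (s t r : V) (X : Set V)
    (hs : s ∉ X) (ht : t ∈ X)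
    (F : Set (Sym2 V) → ℝ) (G : Set (Sym2 V) → Set (Sym2 V) → Set (Sym2 V) → ℝ)
    (hF : Monotone F) (hF0 : ∀ C, 0 ≤ F C)
    (hG1 : ∀ T R, Monotone fun C => G C T R) (hG2 : ∀ C R, Antitone fun T => G C T R)
    (hG3 : ∀ C T, Antitone fun R => G C T R)
    (hG0 : ∀ C T R R', (r = s ∨ ∃ e ∈ C, r ∈ e) → G C T R = G C T R') :
    (prodBernoulli w).real {ω : BondConfig V | ∀ x ∈ X, ¬ (openGraph ω).Reachable s x} *
      (∫ ω in {ω : BondConfig V | ∀ x ∈ X, ¬ (openGraph ω).Reachable s x},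
        F (openEdgeCluster ω t) * G (openEdgeCluster ω s) (openEdgeCluster ω t) (openEdgeCluster ω r)
          ∂(prodBernoulli w)) ≤
    (∫ ω in {ω : BondConfig V | ∀ x ∈ X, ¬ (openGraph ω).Reachable s x},
        F (openEdgeCluster ω t) ∂(prodBernoulli w)) *
      ∫ ω in {ω : BondConfig V | ∀ x ∈ X, ¬ (openGraph ω).Reachable s x},
        G (openEdgeCluster ω s) (openEdgeCluster ω t) (openEdgeCluster ω r) ∂(prodBernoulli w) := by
  classical
  set D : Set (BondConfig V) := {ω | ∀ x ∈ X, ¬ (openGraph ω).Reachable s x} with hDdef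
  have hDmem : ∀ ω, ω ∈ D ↔ ∀ x ∈ X, ¬ (openGraph ω).Reachable s x := fun ω => by rw [hDdef]; rfl
  have hDm : MeasurableSet D := MeasurableSet.of_discrete
  set w' : Sym2 V → ℝ := fun e => (w e : ℝ) with hw'
  have hw0 : ∀ e, 0 ≤ w' e := fun e => (w e).2.1
  have hw1 : ∀ e, w' e ≤ 1 := fun e => (w e).2.2
  -- the integrals as finite sums
  have hint : ∀ h : Set (Sym2 V) → ℝ,
      ∫ ω in D, h ω ∂(prodBernoulli w) = ∑ ω, weight w' ω * (h ω * ind D ω) := by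
    intro h
    rw [← integral_indicator hDm, integral_prodBernoulli_eq_sum]
    refine Finset.sum_congr rfl fun ω _ => ?_
    by_cases hω : ω ∈ D
    · rw [Set.indicator_of_mem hω, ind_of_mem hω, mul_one]
    · rw [Set.indicator_of_notMem hω, ind_of_not_mem hω]; ring
  have hreal : (prodBernoulli w).real D = ∑ ω, weight w' ω * ind D ω := by
    rw [← integral_indicator_one hDm, integral_prodBernoulli_eq_sum]
    refine Finset.sum_congr rfl fun ω _ => ?_
    by_cases hω : ω ∈ D
    · rw [Set.indicator_of_mem hω, ind_of_mem hω, Pi.one_apply]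
    · rw [Set.indicator_of_notMem hω, ind_of_not_mem hω, mul_zero]
  have hm : ∑ ω, weight w' ω = 1 := by
    have h1 := integral_prodBernoulli_eq_sum w fun _ => (1 : ℝ)
    simp only [integral_const, probReal_univ, smul_eq_mul, mul_one] at h1
    exact h1.symm
  -- the two conditional averages as functions of `W`: `F`'s is decreasing, `G`'s increasing
  have hf₁ : Antitone (fun W : Set (Sym2 V) => ∑ η, weight w' η *
      F (openEdgeCluster (η \ {e | ∃ v ∈ e, v = s ∨ ∃ e' ∈ W, v ∈ e'}) t)) := by
    intro W W' hWW'
    refine Finset.sum_le_sum fun η _ => mul_le_mul_of_nonneg_left ?_ (weight_nonneg hw0 hw1 η)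
    exact hF (openEdgeCluster_mono (Set.sdiff_subset_sdiff_right (bar_mono s hWW')) t)
  have hg₁ : Monotone (fun W : Set (Sym2 V) => ∑ η, weight w' η *
      G W (openEdgeCluster (η \ {e | ∃ v ∈ e, v = s ∨ ∃ e' ∈ W, v ∈ e'}) t)
        (openEdgeCluster (η \ {e | ∃ v ∈ e, v = s ∨ ∃ e' ∈ W, v ∈ e'}) r)) := by
    intro W W' hWW'
    refine Finset.sum_le_sum fun η _ => mul_le_mul_of_nonneg_left ?_ (weight_nonneg hw0 hw1 η)
    have hB := bar_mono s hWW'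
    exact (hG1 _ _ hWW').trans
      ((hG2 W' _ (openEdgeCluster_mono (Set.sdiff_subset_sdiff_right hB) t)).trans
        (hG3 W' _ (openEdgeCluster_mono (Set.sdiff_subset_sdiff_right hB) r)))
  -- Theorem 1.3 (increasing/decreasing form) for the two averages given `{C_s ∩ X = ∅}`
  have h13 := BHK2006_clusterConditionalPositiveAssociation_holds.antitone_right V w s X
    (fun W : Set (Sym2 V) => ∑ η, weight w' η *
      G W (openEdgeCluster (η \ {e | ∃ v ∈ e, v = s ∨ ∃ e' ∈ W, v ∈ e'}) t)
        (openEdgeCluster (η \ {e | ∃ v ∈ e, v = s ∨ ∃ e' ∈ W, v ∈ e'}) r)) (fun W : Set (Sym2 V) => ∑ η, weight w' η *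
      F (openEdgeCluster (η \ {e | ∃ v ∈ e, v = s ∨ ∃ e' ∈ W, v ∈ e'}) t)) hg₁ hf₁ hs
  rw [← hDdef] at h13
  rw [hint, hint, hint (fun ω => (∑ η, weight w' η * F
      (openEdgeCluster (η \ {e | ∃ v ∈ e, v = s ∨ ∃ e' ∈ openEdgeCluster ω s, v ∈ e'}) t))), hreal] at h13
  -- the three integrals of the goal, conditioned on `C_s` (display (10))
  rw [hint (fun ω => F (openEdgeCluster ω t)),
    hint (fun ω => G (openEdgeCluster ω s) (openEdgeCluster ω t) (openEdgeCluster ω r)),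
    hint (fun ω => F (openEdgeCluster ω t) *
      G (openEdgeCluster ω s) (openEdgeCluster ω t) (openEdgeCluster ω r)), hreal]
  have e1 := sum_cond_cluster₃_free w' hm s t r X ht (fun _ T _ => F T) (fun _ _ _ _ _ => rfl) hDmem
  have e2 := sum_cond_cluster₃_free w' hm s t r X ht G hG0 hDmem
  have e3 := sum_cond_cluster₃_free w' hm s t r X ht (fun C T R => F T * G C T R)
    (fun C T R R' h => by rw [hG0 C T R R' h]) hDmem
  -- Harris in the fresh variables off `B`, for each `W`
  have hHarris : ∀ (B W : Set (Sym2 V)),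
      ∑ η, weight w' η * (F (openEdgeCluster (η \ B) t) *
        G W (openEdgeCluster (η \ B) t) (openEdgeCluster (η \ B) r)) ≤
      (∑ η, weight w' η * F (openEdgeCluster (η \ B) t)) *
        ∑ η, weight w' η * G W (openEdgeCluster (η \ B) t) (openEdgeCluster (η \ B) r) := fun B W =>
    harris_mono_anti hw0 hw1 hm (f := fun η => F (openEdgeCluster (η \ B) t))
      (g := fun η => G W (openEdgeCluster (η \ B) t) (openEdgeCluster (η \ B) r))
      (fun _ => hF0 _)
      (fun _ _ hab => hF (openEdgeCluster_mono (Set.sdiff_subset_sdiff_left hab) t))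
      (fun _ _ hab => (hG2 W _ (openEdgeCluster_mono (Set.sdiff_subset_sdiff_left hab) t)).trans
        (hG3 W _ (openEdgeCluster_mono (Set.sdiff_subset_sdiff_left hab) r)))
      (M := G W ∅ ∅)
      (fun _ => (hG2 W _ (Set.empty_subset _)).trans (hG3 W _ (Set.empty_subset _)))
  -- Harris on each `{C_s = W}`
  have hH : ∑ ω, weight w' ω * ((∑ η, weight w' η *
        (F (openEdgeCluster (η \ {e | ∃ v ∈ e, v = s ∨ ∃ e' ∈ openEdgeCluster ω s, v ∈ e'}) t) *
         G (openEdgeCluster ω s)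
          (openEdgeCluster (η \ {e | ∃ v ∈ e, v = s ∨ ∃ e' ∈ openEdgeCluster ω s, v ∈ e'}) t)
          (openEdgeCluster (η \ {e | ∃ v ∈ e, v = s ∨ ∃ e' ∈ openEdgeCluster ω s, v ∈ e'}) r))) * ind D ω) ≤
      ∑ ω, weight w' ω * ((∑ η, weight w' η *
          F (openEdgeCluster (η \ {e | ∃ v ∈ e, v = s ∨ ∃ e' ∈ openEdgeCluster ω s, v ∈ e'}) t)) *
        (∑ η, weight w' η * G (openEdgeCluster ω s)
          (openEdgeCluster (η \ {e | ∃ v ∈ e, v = s ∨ ∃ e' ∈ openEdgeCluster ω s, v ∈ e'}) t)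
          (openEdgeCluster (η \ {e | ∃ v ∈ e, v = s ∨ ∃ e' ∈ openEdgeCluster ω s, v ∈ e'}) r)) * ind D ω) :=
    Finset.sum_le_sum fun ω _ => mul_le_mul_of_nonneg_left
      (mul_le_mul_of_nonneg_right (hHarris _ _) (ind_nonneg _ _))
      (weight_nonneg hw0 hw1 ω)
  have hP : 0 ≤ ∑ ω, weight w' ω * ind D ω :=
    Finset.sum_nonneg fun ω _ => mul_nonneg (weight_nonneg hw0 hw1 ω) (ind_nonneg _ _)
  have hcomm : ∑ ω, weight w' ω * ((∑ η, weight w' η * G (openEdgeCluster ω s)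
          (openEdgeCluster (η \ {e | ∃ v ∈ e, v = s ∨ ∃ e' ∈ openEdgeCluster ω s, v ∈ e'}) t)
          (openEdgeCluster (η \ {e | ∃ v ∈ e, v = s ∨ ∃ e' ∈ openEdgeCluster ω s, v ∈ e'}) r)) *
        (∑ η, weight w' η * F
          (openEdgeCluster (η \ {e | ∃ v ∈ e, v = s ∨ ∃ e' ∈ openEdgeCluster ω s, v ∈ e'}) t)) * ind D ω) =
      ∑ ω, weight w' ω * ((∑ η, weight w' η *
          F (openEdgeCluster (η \ {e | ∃ v ∈ e, v = s ∨ ∃ e' ∈ openEdgeCluster ω s, v ∈ e'}) t)) *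
        (∑ η, weight w' η * G (openEdgeCluster ω s)
          (openEdgeCluster (η \ {e | ∃ v ∈ e, v = s ∨ ∃ e' ∈ openEdgeCluster ω s, v ∈ e'}) t)
          (openEdgeCluster (η \ {e | ∃ v ∈ e, v = s ∨ ∃ e' ∈ openEdgeCluster ω s, v ∈ e'}) r)) * ind D ω) :=
    Finset.sum_congr rfl fun ω _ => by ring
  rw [e1, e2, e3]
  rw [hcomm] at h13
  nlinarith [mul_le_mul_of_nonneg_left hH hP, h13]

/-! ### The event form under `{u ↮ v}` alone ("Step 1′" for the kernel's own conditioning) -/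

open ThreeClusterTwoLevelFree in
/-- **Step 1′ under `{u ↮ v}`.**  For relays `u ≠ v`, a spectator `c`, an observer `o` and an event `A` increasing in the open cluster of
`v`: with `D = {u ↮ v}` and `Z₁ = {u ↔ o} ∪ ({v ↮ o} ∩ ({u ↔ c} ∪ {c ↮ o}))` (`o` is swallowed by the cluster of `u`, or `o` is reached
neither from `v` nor — unless `c` itself is swallowed by the cluster of `u` — from `c`),
`μ(D) μ(D ∩ (A ∩ Z₁)) ≤ μ(D ∩ A) μ(D ∩ Z₁)`.
[cite: VandenbergHaggstromKahn2005, Thm. 1.5 (p. 7) and Thm. 1.3 (p. 6)] -/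
theorem stepOne_event₁ {V : Type} [Fintype V] (w : Sym2 V → unitInterval) (u v c o : V) (huv : u ≠ v)
    {A : Set (BondConfig V)}
    (hA : ∀ ⦃ω ω' : BondConfig V⦄, openEdgeCluster ω v ⊆ openEdgeCluster ω' v → ω ∈ A → ω' ∈ A) :
    (prodBernoulli w).real (openConn u v)ᶜ *
      (prodBernoulli w).real ((openConn u v)ᶜ ∩
        (A ∩ (openConn u o ∪ ((openConn v o)ᶜ ∩ (openConn u c ∪ (openConn c o)ᶜ))))) ≤
    (prodBernoulli w).real ((openConn u v)ᶜ ∩ A) *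
      (prodBernoulli w).real ((openConn u v)ᶜ ∩
        (openConn u o ∪ ((openConn v o)ᶜ ∩ (openConn u c ∪ (openConn c o)ᶜ)))) := by
  classical
  let F : Set (Sym2 V) → ℝ := fun C => if ∃ ω ∈ A, openEdgeCluster ω v ⊆ C then 1 else 0
  let G : Set (Sym2 V) → Set (Sym2 V) → Set (Sym2 V) → ℝ := fun C T R =>
    if (o = u ∨ ∃ e ∈ C, o ∈ e) ∨ (¬ (o = v ∨ ∃ e ∈ T, o ∈ e) ∧ ((c = u ∨ ∃ e ∈ C, c ∈ e) ∨ ¬ (o = c ∨ ∃ e ∈ R, o ∈ e)))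
    then 1 else 0
  have hF : Monotone F := by
    intro C C' hCC'
    simp only [F]
    by_cases h : ∃ ω ∈ A, openEdgeCluster ω v ⊆ C
    · obtain ⟨ω, hω, h1⟩ := h
      rw [if_pos ⟨ω, hω, h1⟩, if_pos ⟨ω, hω, h1.trans hCC'⟩]
    · rw [if_neg h]; split_ifs <;> norm_num
  have hF0 : ∀ C, 0 ≤ F C := fun C => by simp only [F]; split_ifs <;> norm_num
  have hG1 : ∀ T R, Monotone fun C => G C T R := by
    intro T R C C' hCC'
    simp only [G]
    by_cases h : (o = u ∨ ∃ e ∈ C, o ∈ e) ∨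
        (¬ (o = v ∨ ∃ e ∈ T, o ∈ e) ∧ ((c = u ∨ ∃ e ∈ C, c ∈ e) ∨ ¬ (o = c ∨ ∃ e ∈ R, o ∈ e)))
    · rw [if_pos h, if_pos (h.imp (fun h' => h'.imp id fun ⟨e, he, hoe⟩ => ⟨e, hCC' he, hoe⟩)
        fun ⟨h1, h2⟩ => ⟨h1, h2.imp (fun h' => h'.imp id fun ⟨e, he, hce⟩ => ⟨e, hCC' he, hce⟩) id⟩)]
    · rw [if_neg h]; split_ifs <;> norm_num
  have hG2 : ∀ C R, Antitone fun T => G C T R := by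
    intro C R T T' hTT'
    simp only [G]
    by_cases h : (o = u ∨ ∃ e ∈ C, o ∈ e) ∨
        (¬ (o = v ∨ ∃ e ∈ T', o ∈ e) ∧ ((c = u ∨ ∃ e ∈ C, c ∈ e) ∨ ¬ (o = c ∨ ∃ e ∈ R, o ∈ e)))
    · rw [if_pos h, if_pos (h.imp id fun ⟨h1, h2⟩ =>
        ⟨fun h' => h1 (h'.imp id fun ⟨e, he, hoe⟩ => ⟨e, hTT' he, hoe⟩), h2⟩)]
    · rw [if_neg h]; split_ifs <;> norm_num
  have hG3 : ∀ C T, Antitone fun R => G C T R := by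
    intro C T R R' hRR'
    simp only [G]
    by_cases h : (o = u ∨ ∃ e ∈ C, o ∈ e) ∨
        (¬ (o = v ∨ ∃ e ∈ T, o ∈ e) ∧ ((c = u ∨ ∃ e ∈ C, c ∈ e) ∨ ¬ (o = c ∨ ∃ e ∈ R', o ∈ e)))
    · rw [if_pos h, if_pos (h.imp id fun ⟨h1, h2⟩ =>
        ⟨h1, h2.imp id fun h' h'' => h' (h''.imp id fun ⟨e, he, hoe⟩ => ⟨e, hRR' he, hoe⟩)⟩)]
    · rw [if_neg h]; split_ifs <;> norm_num
  have hG0 : ∀ C T R R', (c = u ∨ ∃ e ∈ C, c ∈ e) → G C T R = G C T R' := by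
    intro C T R R' hc
    simp only [G, hc, true_or, and_true]
  set Z : Set (BondConfig V) := openConn u o ∪ ((openConn v o)ᶜ ∩ (openConn u c ∪ (openConn c o)ᶜ)) with hZ
  have F_eval : ∀ ω, F (openEdgeCluster ω v) = A.indicator 1 ω := by
    intro ω
    simp only [F]
    by_cases hω : ω ∈ A
    · rw [if_pos ⟨ω, hω, subset_rfl⟩, Set.indicator_of_mem hω, Pi.one_apply]
    · rw [Set.indicator_of_notMem hω, if_neg]
      rintro ⟨ω', hω', h1⟩
      exact hω (hA h1 hω')
  have G_eval : ∀ ω, G (openEdgeCluster ω u) (openEdgeCluster ω v) (openEdgeCluster ω c) = Z.indicator 1 ω := by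
    intro ω
    have hZmem : ω ∈ Z ↔ ((o = u ∨ ∃ e ∈ openEdgeCluster ω u, o ∈ e) ∨
        (¬ (o = v ∨ ∃ e ∈ openEdgeCluster ω v, o ∈ e) ∧
          ((c = u ∨ ∃ e ∈ openEdgeCluster ω u, c ∈ e) ∨ ¬ (o = c ∨ ∃ e ∈ openEdgeCluster ω c, o ∈ e)))) := by
      rw [hZ]
      simp only [Set.mem_union, Set.mem_inter_iff, Set.mem_compl_iff]
      rw [← reachable_iff_exists_mem_openEdgeCluster ω u o, ← reachable_iff_exists_mem_openEdgeCluster ω v o,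
        ← reachable_iff_exists_mem_openEdgeCluster ω u c, ← reachable_iff_exists_mem_openEdgeCluster ω c o]
      rfl
    simp only [G]
    by_cases hω : ω ∈ Z
    · rw [if_pos (hZmem.1 hω), Set.indicator_of_mem hω, Pi.one_apply]
    · rw [if_neg (fun h => hω (hZmem.2 h)), Set.indicator_of_notMem hω]
  have hs : u ∉ ({v} : Set V) := by simpa using huv
  have key := threeClusterTwoLevel_free w u v c {v} hs (Set.mem_singleton v) F G hF hF0 hG1 hG2 hG3 hG0
  have hD : {ω : BondConfig V | ∀ x ∈ ({v} : Set V), ¬ (openGraph ω).Reachable u x} = (openConn u v)ᶜ := by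
    ext ω
    simp only [Set.mem_setOf_eq, Set.mem_singleton_iff, forall_eq, Set.mem_compl_iff]
    rfl
  simp only [hD, F_eval, G_eval, KNPreFKG.indicator_one_mul_indicator_one,
    KNPreFKG.setIntegral_indicator_one_eq] at key
  exact key

end Summit.CriticalPhenomena.PercolationContinuityZ3.Theorems
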